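import Mathlib
import Summits.MatrixMultiplication.MatrixMultiplication.Theses.GelfandPairHosts

/-!
# `GelfandPairHosts.KillGlue` (stmt-MatrixMultiplication-7388):
# rigidity of module-TPP designs refutes Gelfand hosting, `GelfandRigidity → ¬ GelfandHosting`

Route `MatrixMultiplication/GelfandPairHosts`, support item (kill glue).  Notation: a finite group
`G` acts on a finite set `X` (`N = |X|`), `P_g` is the permutation matrix `(P_g) y x = [g • x = y]`,
`D = dim span {P_g}` is the host cost, and a module-TPP design of size `(a,b,c)` is a triple of maps
`φ : [a]×[b] → G`, `ψ : [b]×[c] → X`, `χ : [a]×[c] → X` with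
`φ(i,j) • ψ(j',k) = χ(i',k') ↔ (i,j,k) = (i',j',k')`.

Proof (the planner's sketch, made exact).
* Capacity side (elementary): `ψ` and `χ` are injective, so `bc ≤ N` and `ac ≤ N`
  (`killGlue_bc_le_card`, `killGlue_ac_le_card`); the matrices `P_{φ(i,j)}` have the private
  non-zero entry `(χ(i,k₀), ψ(j,k₀))`, so they are linearly independent and `ab ≤ D`
  (`killGlue_ab_le_finrank`, via the general private-position lemma
  `killGlue_card_le_finrank_of_private`).
* Cost side: a commutative commutant forces transitivity (`killGlue_transitive_of_comm`: for two
  orbits the row-indicator matrices `[u ∈ O_y]`, `[u ∈ O_x]` are invariant and do not commute), and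
  a transitive action has `N ≤ D` (`killGlue_card_le_finrank`: the matrices `P_{g_y}`, `g_y • x₀ = y`,
  have private entries `(y, x₀)`).
* Arithmetic (`killGlue_log_ineq`): write `x = log (abc) > 0`, `LN = log N`, `LD = log D` and
  `C' = max C 1`.  Rigidity gives `x ≤ LN + C (LD - LN) ≤ LN + C' (LD - LN)` (as `LN ≤ LD`), hosting
  gives `LD ≤ (2+ε) x / 3`, and the capacity bounds give `2 LN + LD ≥ 2x`, whence
  `LD - LN ≤ ε x / 2`.  With `ε = 1/(3C'+3)` (so `C' ε = 1/3 - ε`) this reads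
  `x ≤ (2+ε)x/3 + (1/3 - ε) x/2 = (5 - ε) x / 6 < x`, a contradiction.

No new definitions; only Mathlib is used (`finrank_span_eq_card`, `Submodule.finrank_mono`,
`Fintype.linearIndependent_iff`, `MulAction.orbit_eq_iff`, `Real.log_le_log`, `Real.log_rpow`).
-/

-- the tree's namespace `Summit.MatrixMultiplication.MatrixMultiplication.…` repeats a component by design
set_option linter.dupNamespace false

namespace Summit.MatrixMultiplication.MatrixMultiplication.Theorems

open scoped BigOperators
open Summit.MatrixMultiplication.MatrixMultiplication.Theses.GelfandPairHosts
  (GelfandRigidity GelfandHosting KillGlue)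

/-! ## Linear independence from private positions -/

/-- Private-position lemma: if `t : ι → G`, `p q : ι → X` satisfy `t i' • q i = p i ↔ i' = i`, then
the permutation matrices `P_{t i}` (`(P_g) y x = [g • x = y]`) are linearly independent — the entry
`(p i, q i)` of `P_{t i'}` is `[i' = i]` — so `|ι| ≤ D = dim span {P_g}`. [folklore] -/
theorem killGlue_card_le_finrank_of_private {G X ι : Type*} [Group G] [MulAction G X]
    [Fintype X] [DecidableEq X] [Fintype ι] (t : ι → G) (p q : ι → X)
    (h : ∀ i i', t i' • q i = p i ↔ i' = i) :
    Fintype.card ι ≤ Module.finrank ℂ (Submodule.span ℂ (Set.range fun g : G =>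
      Matrix.of fun y x : X => if g • x = y then (1 : ℂ) else 0)) := by
  set P : G → Matrix X X ℂ := fun g => Matrix.of fun y x : X => if g • x = y then (1 : ℂ) else 0
    with hP
  have hli : LinearIndependent ℂ (P ∘ t) := by
    rw [Fintype.linearIndependent_iff]
    intro g hg i
    have h1 := congr_fun (congr_fun hg (p i)) (q i)
    rw [Matrix.sum_apply, Matrix.zero_apply] at h1
    rw [Finset.sum_eq_single i] at h1
    · simpa [hP, (h i i).mpr rfl] using h1
    · intro i' _ hi'
      have hne : ¬ (t i' • q i = p i) := fun h' => hi' ((h i i').mp h')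
      simp [hP, hne]
    · intro hi
      exact absurd (Finset.mem_univ i) hi
  calc Fintype.card ι = Module.finrank ℂ (Submodule.span ℂ (Set.range (P ∘ t))) :=
        (finrank_span_eq_card hli).symm
    _ ≤ Module.finrank ℂ (Submodule.span ℂ (Set.range P)) :=
        Submodule.finrank_mono (Submodule.span_mono (Set.range_comp_subset_range t P))

/-! ## Capacity bounds of a module-TPP design -/

section Design

variable {G X : Type*} [Group G] [MulAction G X] [Fintype X] {a b c : ℕ}
  (φ : Fin a × Fin b → G) (ψ : Fin b × Fin c → X) (χ : Fin a × Fin c → X)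

/-- In a module-TPP design `ψ` is injective (test against `φ(i₀,j)`), so `bc ≤ |X|`. [folklore] -/
theorem killGlue_bc_le_card (i₀ : Fin a)
    (hdes : ∀ (i i' : Fin a) (j j' : Fin b) (k k' : Fin c),
      φ (i, j) • ψ (j', k) = χ (i', k') ↔ (i = i' ∧ j = j' ∧ k = k')) :
    b * c ≤ Fintype.card X := by
  have hinj : Function.Injective ψ := by
    rintro ⟨j, k⟩ ⟨j', k'⟩ hjk
    have h1 : φ (i₀, j) • ψ (j, k) = χ (i₀, k) := (hdes i₀ i₀ j j k k).mpr ⟨rfl, rfl, rfl⟩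
    rw [hjk] at h1
    obtain ⟨-, hj, hk⟩ := (hdes i₀ i₀ j j' k' k).mp h1
    rw [hj, hk]
  simpa [Fintype.card_prod, Fintype.card_fin] using Fintype.card_le_of_injective ψ hinj

/-- In a module-TPP design `χ` is injective (test against `φ(i,j₀) • ψ(j₀,k)`), so `ac ≤ |X|`.
[folklore] -/
theorem killGlue_ac_le_card (j₀ : Fin b)
    (hdes : ∀ (i i' : Fin a) (j j' : Fin b) (k k' : Fin c),
      φ (i, j) • ψ (j', k) = χ (i', k') ↔ (i = i' ∧ j = j' ∧ k = k')) :
    a * c ≤ Fintype.card X := by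
  have hinj : Function.Injective χ := by
    rintro ⟨i, k⟩ ⟨i', k'⟩ hik
    have h1 : φ (i, j₀) • ψ (j₀, k) = χ (i, k) := (hdes i i j₀ j₀ k k).mpr ⟨rfl, rfl, rfl⟩
    rw [hik] at h1
    obtain ⟨hi, -, hk⟩ := (hdes i i' j₀ j₀ k k').mp h1
    rw [hi, hk]
  simpa [Fintype.card_prod, Fintype.card_fin] using Fintype.card_le_of_injective χ hinj

variable [DecidableEq X]

/-- In a module-TPP design the matrices `P_{φ(i,j)}` have private entries `(χ(i,k₀), ψ(j,k₀))`,
so `ab ≤ D = dim span {P_g}`. [folklore] -/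
theorem killGlue_ab_le_finrank (k₀ : Fin c)
    (hdes : ∀ (i i' : Fin a) (j j' : Fin b) (k k' : Fin c),
      φ (i, j) • ψ (j', k) = χ (i', k') ↔ (i = i' ∧ j = j' ∧ k = k')) :
    a * b ≤ Module.finrank ℂ (Submodule.span ℂ (Set.range fun g : G =>
      Matrix.of fun y x : X => if g • x = y then (1 : ℂ) else 0)) := by
  have h := killGlue_card_le_finrank_of_private (ι := Fin a × Fin b) φ
    (fun ij => χ (ij.1, k₀)) (fun ij => ψ (ij.2, k₀)) (by
      rintro ⟨i, j⟩ ⟨i', j'⟩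
      rw [hdes i' i j' j k₀ k₀]
      simp [Prod.ext_iff])
  simpa [Fintype.card_prod, Fintype.card_fin] using h

end Design

/-! ## Cost bounds: multiplicity-free ⇒ transitive ⇒ `N ≤ D` -/

section Cost

variable {G X : Type*} [Group G] [MulAction G X] [Fintype X]

/-- If the commutant of the permutation module `ℂ[X]` is commutative then `G` is transitive on `X`:
for two distinct orbits `O_x ∌ y` the invariant row-indicator matrices `A u v = [u ∈ O_y]`,
`B u v = [u ∈ O_x]` satisfy `(AB)_{yy} = |O_x| ≠ 0 = (BA)_{yy}`. [folklore] -/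
theorem killGlue_transitive_of_comm
    (hmf : ∀ A B : Matrix X X ℂ, (∀ (g : G) (x y : X), A (g • x) (g • y) = A x y) →
      (∀ (g : G) (x y : X), B (g • x) (g • y) = B x y) → A * B = B * A)
    (x y : X) : ∃ g : G, g • x = y := by
  classical
  by_contra hne
  have hy : y ∉ MulAction.orbit G x := fun h => hne (MulAction.mem_orbit_iff.mp h)
  -- invariant row-indicator matrices of the two orbits
  set A : Matrix X X ℂ := Matrix.of fun u _ => if u ∈ MulAction.orbit G y then (1 : ℂ) else 0
    with hA
  set B : Matrix X X ℂ := Matrix.of fun u _ => if u ∈ MulAction.orbit G x then (1 : ℂ) else 0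
    with hB
  have hinv : ∀ (z : X) (g : G) (u : X),
      (g • u ∈ MulAction.orbit G z ↔ u ∈ MulAction.orbit G z) := by
    intro z g u
    rw [← MulAction.orbit_eq_iff, MulAction.orbit_smul, MulAction.orbit_eq_iff]
  have hAi : ∀ (g : G) (u v : X), A (g • u) (g • v) = A u v := by
    intro g u v
    simp only [hA, Matrix.of_apply, hinv]
  have hBi : ∀ (g : G) (u v : X), B (g • u) (g • v) = B u v := by
    intro g u v
    simp only [hB, Matrix.of_apply, hinv]
  have hcomm := congr_fun (congr_fun (hmf A B hAi hBi) y) y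
  rw [Matrix.mul_apply, Matrix.mul_apply] at hcomm
  -- right-hand side vanishes: `B y z = [y ∈ O_x] = 0`
  have hrhs : ∑ z, B y z * A z y = 0 := by
    refine Finset.sum_eq_zero fun z _ => ?_
    simp [hB, hy]
  -- left-hand side is `|O_x| ≠ 0`
  have hlhs : ∑ z, A y z * B z y = ((Finset.univ.filter fun z => z ∈ MulAction.orbit G x).card : ℂ) := by
    have : ∀ z, A y z * B z y = if z ∈ MulAction.orbit G x then (1 : ℂ) else 0 := by
      intro z
      simp [hA, hB, MulAction.mem_orbit_self]
    simp only [this, Finset.sum_boole]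
  rw [hrhs, hlhs, Nat.cast_eq_zero, Finset.card_eq_zero, Finset.filter_eq_empty_iff] at hcomm
  exact hcomm (Finset.mem_univ x) (MulAction.mem_orbit_self x)

variable [DecidableEq X]

/-- A transitive action on a nonempty set has `|X| ≤ D = dim span {P_g}`: choosing `g_y` with
`g_y • x₀ = y`, the matrix `P_{g_y}` has the private entry `(y, x₀)`. [folklore] -/
theorem killGlue_card_le_finrank (x₀ : X) (htrans : ∀ x y : X, ∃ g : G, g • x = y) :
    Fintype.card X ≤ Module.finrank ℂ (Submodule.span ℂ (Set.range fun g : G =>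
      Matrix.of fun y x : X => if g • x = y then (1 : ℂ) else 0)) := by
  choose t ht using fun y => htrans x₀ y
  refine killGlue_card_le_finrank_of_private t id (fun _ => x₀) ?_
  intro y y'
  constructor
  · intro h
    rw [ht y'] at h
    exact h
  · rintro rfl
    exact ht y'

end Cost

/-! ## The arithmetic -/

/-- The log-linear bookkeeping of the kill: with `x = la + lb + lc > 0` (`= log abc`),
`lb + lc ≤ LN`, `la + lc ≤ LN`, `la + lb ≤ LD`, `LN ≤ LD ≤ (2+ε)x/3`, rigidity
`x ≤ LN + C (LD - LN)` with `C ≥ 1`, and `ε = 1/(3C+3)`, one gets `x ≤ (5-ε)x/6`, absurd.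
[folklore] -/
theorem killGlue_log_ineq (C ε x la lb lc LN LD : ℝ) (hC : 1 ≤ C) (hε : ε = 1 / (3 * C + 3))
    (hx : x = la + lb + lc) (hxpos : 0 < x) (h1 : lb + lc ≤ LN) (h2 : la + lc ≤ LN)
    (h3 : la + lb ≤ LD) (h4 : LN ≤ LD) (h5 : LD ≤ (2 + ε) / 3 * x)
    (h6 : x ≤ LN + C * (LD - LN)) : False := by
  have hεpos : 0 < ε := by rw [hε]; positivity
  have hεC : ε * C = 1 / 3 - ε := by
    rw [hε]
    field_simp
    ring
  -- `LD - LN ≤ ε x / 2`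
  have hgap : LD - LN ≤ ε * x / 2 := by nlinarith
  have hA : C * (LD - LN) ≤ C * (ε * x / 2) := mul_le_mul_of_nonneg_left hgap (by linarith)
  have hB : C * (ε * x / 2) = x / 6 - ε * x / 2 := by
    have : C * (ε * x / 2) = (ε * C) * x / 2 := by ring
    rw [this, hεC]
    ring
  have hpos : 0 < ε * x := mul_pos hεpos hxpos
  nlinarith

/-! ## The kill glue -/

/-- **KillGlue** (item stmt-MatrixMultiplication-7388 of route `GelfandPairHosts`):
`GelfandRigidity → ¬ GelfandHosting`.  Given the rigidity exponent `C`, put `C' = max C 1` and test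
hosting at `ε = 1/(3C'+3)`: the design gives `bc, ac ≤ N`, `ab ≤ D`, multiplicity-freeness gives
`N ≤ D`, and `killGlue_log_ineq` derives the contradiction. -/
theorem killGlue_proof : KillGlue := by
  unfold KillGlue GelfandRigidity GelfandHosting
  rintro ⟨C, hC⟩ hX
  set C' : ℝ := max C 1 with hC'
  have hC'1 : (1 : ℝ) ≤ C' := le_max_right _ _
  have hCC' : C ≤ C' := le_max_left _ _
  set ε : ℝ := 1 / (3 * C' + 3) with hε
  have hεpos : 0 < ε := by rw [hε]; positivity
  obtain ⟨G, iG, iFG, X, iFX, iDX, iMA, a, b, c, φ, ψ, χ, hmf, habc, hdes, hD⟩ := hX ε hεpos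
  have hrig := hC G X a b c φ ψ χ hmf hdes
  -- `a, b, c ≥ 1`
  have ha : 0 < a := Nat.pos_of_ne_zero fun h => by simp [h] at habc
  have hb : 0 < b := Nat.pos_of_ne_zero fun h => by simp [h] at habc
  have hc : 0 < c := Nat.pos_of_ne_zero fun h => by simp [h] at habc
  -- capacity and cost bounds (in `ℕ`)
  have hbc := killGlue_bc_le_card φ ψ χ ⟨0, ha⟩ hdes
  have hac := killGlue_ac_le_card φ ψ χ ⟨0, hb⟩ hdes
  have hab := killGlue_ab_le_finrank φ ψ χ ⟨0, hc⟩ hdes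
  have htrans : ∀ x y : X, ∃ g : G, g • x = y := killGlue_transitive_of_comm hmf
  have hND := killGlue_card_le_finrank (G := G) (ψ (⟨0, hb⟩, ⟨0, hc⟩)) htrans
  -- abbreviations (reals)
  set D : ℕ := Module.finrank ℂ (Submodule.span ℂ (Set.range fun g : G =>
      Matrix.of fun y x : X => if g • x = y then (1 : ℂ) else 0)) with hDdef
  set N : ℕ := Fintype.card X with hNdef
  have haR : (1 : ℝ) ≤ a := by exact_mod_cast ha
  have hbR : (1 : ℝ) ≤ b := by exact_mod_cast hb
  have hcR : (1 : ℝ) ≤ c := by exact_mod_cast hc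
  have hbcR : (b : ℝ) * c ≤ N := by exact_mod_cast hbc
  have hacR : (a : ℝ) * c ≤ N := by exact_mod_cast hac
  have habR : (a : ℝ) * b ≤ D := by exact_mod_cast hab
  have hNDR : (N : ℝ) ≤ D := by exact_mod_cast hND
  have hNpos : (0 : ℝ) < N := by nlinarith
  have hDpos : (0 : ℝ) < D := lt_of_lt_of_le hNpos hNDR
  have hnR : ((a * b * c : ℕ) : ℝ) = (a : ℝ) * b * c := by push_cast; ring
  have hn2 : (2 : ℝ) ≤ (a : ℝ) * b * c := by rw [← hnR]; exact_mod_cast habc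
  have hnpos : (0 : ℝ) < (a : ℝ) * b * c := by linarith
  -- logs
  have hxsplit : Real.log ((a : ℝ) * b * c) = Real.log a + Real.log b + Real.log c := by
    rw [Real.log_mul (by positivity) (by positivity), Real.log_mul (by positivity) (by positivity)]
  have hxpos : 0 < Real.log ((a : ℝ) * b * c) := Real.log_pos (by linarith)
  have h1 : Real.log b + Real.log c ≤ Real.log N := by
    rw [← Real.log_mul (by positivity) (by positivity)]
    exact Real.log_le_log (by positivity) hbcR
  have h2 : Real.log a + Real.log c ≤ Real.log N := by
    rw [← Real.log_mul (by positivity) (by positivity)]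
    exact Real.log_le_log (by positivity) hacR
  have h3 : Real.log a + Real.log b ≤ Real.log D := by
    rw [← Real.log_mul (by positivity) (by positivity)]
    exact Real.log_le_log (by positivity) habR
  have h4 : Real.log N ≤ Real.log D := Real.log_le_log hNpos hNDR
  have h5 : Real.log D ≤ (2 + ε) / 3 * Real.log ((a : ℝ) * b * c) := by
    rw [hnR] at hD
    have := Real.log_le_log hDpos hD
    rwa [Real.log_rpow hnpos] at this
  have h6 : Real.log ((a : ℝ) * b * c) ≤ Real.log N + C' * (Real.log D - Real.log N) := by
    rw [hnR] at hrig
    have hl := Real.log_le_log (by positivity) hrig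
    rw [Real.log_mul hnpos.ne' (by positivity), Real.log_mul hNpos.ne' (by positivity),
      Real.log_rpow hNpos, Real.log_rpow hDpos] at hl
    have hmono : C * (Real.log D - Real.log N) ≤ C' * (Real.log D - Real.log N) :=
      mul_le_mul_of_nonneg_right hCC' (sub_nonneg.mpr h4)
    nlinarith
  exact killGlue_log_ineq C' ε _ _ _ _ _ _ hC'1 hε hxsplit hxpos h1 h2 h3 h4 h5 h6

end Summit.MatrixMultiplication.MatrixMultiplication.Theorems
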